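import Mathlib

/-!
# Holomorphy of parameter integrals under a uniform dominating bound

Blind cell `pub-hodge-repro2`, seat p1 (gen 12), Tier-5 kernel support for the S4 row
«absolute convergence propagates; dominated convergence; holomorphy on Re s > ½ − ε» of
`route/T5-SUPPORT-p1.md` §S4 (step (P1) of `route/T5-N4-p5.md`), which the coverage map classes as
[A] «standard analysis, not modelled».  The standard fact is:

> if `F z a` is holomorphic in the parameter `z` on an open set `U ⊆ ℂ` for a.e. `a`, measurable in
> `a` for each `z ∈ U`, and dominated on all of `U` by one integrable function `bound a`, then
> `z ↦ ∫ F z a dμ` is holomorphic on `U`, with derivative `∫ ∂_z F z a dμ` («differentiation under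
> the integral sign»), and every `F z`, `z ∈ U`, is integrable («absolute convergence propagates»).

Proof: Mathlib's `hasDerivAt_integral_of_dominated_loc_of_deriv_le` needs a uniform integrable bound on
the DERIVATIVE near `z₀`; the Cauchy estimate `Complex.norm_deriv_le_of_forall_mem_sphere_norm_le`
(`‖f'(c)‖ ≤ C / R` when `‖f‖ ≤ C` on the circle of radius `R` about `c`) turns the bound on `F` over a
disc inside `U` into the bound `bound a / (ρ/4)` on `∂_z F` over a smaller disc.  The measurability of
`a ↦ ∂_z F z₀ a` is the a.e. limit of the difference quotients along `t_n = (ρ/2)/(n+1) → 0`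
(`aestronglyMeasurable_of_tendsto_ae`).

The half-plane form `differentiableOn_integral_of_dominated_halfPlane` is the shape used in (P1):
`U = {s : Re s > c}`.  Nothing here is specific to the cell; the file is pure Mathlib.
-/

namespace Summit.Ventures.HodgeRepro2.T5ParametricHolomorphy

open MeasureTheory Filter Topology Metric

variable {α : Type*} [MeasurableSpace α] {μ : Measure α}
variable {E : Type*} [NormedAddCommGroup E] [NormedSpace ℂ E]

/-- The `z`-derivative of a parameter-dependent function is a.e.-strongly measurable in the
parameter `a`, as the a.e. limit of the difference quotients along `t n = (ρ/2)/(n+1) → 0` (the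
values `F (z₀ + t n)` are measurable because `z₀ + t n` stays in the ball of radius `ρ`). -/
theorem aestronglyMeasurable_deriv_param {F : ℂ → α → E} {z₀ : ℂ} {ρ : ℝ} (hρ : 0 < ρ)
    (hF_meas : ∀ z ∈ ball z₀ ρ, AEStronglyMeasurable (F z) μ)
    (h_diff : ∀ᵐ a ∂μ, DifferentiableAt ℂ (F · a) z₀) :
    AEStronglyMeasurable (fun a => deriv (F · a) z₀) μ := by
  set t : ℕ → ℂ := fun n => ((ρ / 2 * (1 / ((n : ℝ) + 1)) : ℝ) : ℂ) with ht_def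
  have ht_pos : ∀ n : ℕ, 0 < ρ / 2 * (1 / ((n : ℝ) + 1)) := fun n => by positivity
  have ht_ne : ∀ n, t n ≠ 0 := fun n => Complex.ofReal_ne_zero.mpr (ht_pos n).ne'
  have ht_mem : ∀ n, z₀ + t n ∈ ball z₀ ρ := by
    intro n
    rw [mem_ball, dist_self_add_left, Complex.norm_real, Real.norm_eq_abs, abs_of_pos (ht_pos n)]
    have hn : (1 : ℝ) / ((n : ℝ) + 1) ≤ 1 :=
      div_le_one_of_le₀ (by linarith [(n.cast_nonneg : (0 : ℝ) ≤ n)]) (by positivity)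
    calc ρ / 2 * (1 / ((n : ℝ) + 1)) ≤ ρ / 2 * 1 := by gcongr
      _ < ρ := by linarith
  have ht_tendsto : Tendsto t atTop (𝓝[≠] 0) := by
    rw [tendsto_nhdsWithin_iff]
    refine ⟨?_, Eventually.of_forall fun n => ht_ne n⟩
    have h1 : Tendsto (fun n : ℕ => ρ / 2 * (1 / ((n : ℝ) + 1))) atTop (𝓝 (ρ / 2 * 0)) :=
      (tendsto_one_div_add_atTop_nhds_zero_nat (𝕜 := ℝ)).const_mul (ρ / 2)
    rw [mul_zero] at h1
    have := (Complex.continuous_ofReal.tendsto 0).comp h1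
    simpa [ht_def, Function.comp_def] using this
  refine aestronglyMeasurable_of_tendsto_ae atTop
    (f := fun n a => (t n)⁻¹ • (F (z₀ + t n) a - F z₀ a)) (fun n => ?_) ?_
  · exact ((hF_meas _ (ht_mem n)).sub (hF_meas z₀ (mem_ball_self hρ))).const_smul _
  · filter_upwards [h_diff] with a ha
    exact (hasDerivAt_iff_tendsto_slope_zero.mp ha.hasDerivAt).comp ht_tendsto

omit [NormedSpace ℂ E] in
/-- **Absolute convergence propagates**: under a dominating bound uniform on `U`, every `F z`,
`z ∈ U`, is integrable. -/
theorem integrable_of_dominated_on {U : Set ℂ} {F : ℂ → α → E} {bound : α → ℝ}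
    (hF_meas : ∀ z ∈ U, AEStronglyMeasurable (F z) μ)
    (h_bound : ∀ᵐ a ∂μ, ∀ z ∈ U, ‖F z a‖ ≤ bound a) (bound_int : Integrable bound μ) :
    ∀ z ∈ U, Integrable (F z) μ :=
  fun z hz => bound_int.mono' (hF_meas z hz) (h_bound.mono fun _ ha => ha z hz)

/-- **Differentiation under the integral sign, holomorphic version**: `F z a` holomorphic in `z` on
an open `U` for a.e. `a`, measurable in `a` for each `z ∈ U`, dominated on `U` by an integrable
`bound`; then at every `z₀ ∈ U` the derivative `a ↦ ∂_z F z₀ a` is integrable and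
`z ↦ ∫ F z a dμ` has derivative `∫ ∂_z F z₀ a dμ` at `z₀`.  (Cauchy estimate on a disc of radius
`ρ/4` inside the disc of radius `ρ/2` inside `U`, then Mathlib's
`hasDerivAt_integral_of_dominated_loc_of_deriv_le`.) -/
theorem hasDerivAt_integral_of_dominated_on {U : Set ℂ} (hU : IsOpen U) {F : ℂ → α → E}
    {bound : α → ℝ} (hF_meas : ∀ z ∈ U, AEStronglyMeasurable (F z) μ)
    (hF_diff : ∀ᵐ a ∂μ, DifferentiableOn ℂ (F · a) U)
    (h_bound : ∀ᵐ a ∂μ, ∀ z ∈ U, ‖F z a‖ ≤ bound a) (bound_int : Integrable bound μ)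
    {z₀ : ℂ} (hz₀ : z₀ ∈ U) :
    Integrable (fun a => deriv (F · a) z₀) μ ∧
      HasDerivAt (fun z => ∫ a, F z a ∂μ) (∫ a, deriv (F · a) z₀ ∂μ) z₀ := by
  obtain ⟨ρ, hρ, hball⟩ := Metric.isOpen_iff.mp hU z₀ hz₀
  have hclosed : closedBall z₀ (ρ / 2) ⊆ U :=
    (closedBall_subset_ball (by linarith)).trans hball
  have hs : ball z₀ (ρ / 4) ∈ 𝓝 z₀ := ball_mem_nhds _ (by positivity)
  have hsU : ball z₀ (ρ / 4) ⊆ U := (ball_subset_ball (by linarith)).trans hball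
  refine hasDerivAt_integral_of_dominated_loc_of_deriv_le (F' := fun z a => deriv (F · a) z)
    (bound := fun a => bound a / (ρ / 4)) hs ?_ ?_ ?_ ?_ ?_ ?_
  · exact Filter.eventually_of_mem (hU.mem_nhds hz₀) hF_meas
  · exact bound_int.mono' (hF_meas z₀ hz₀) (h_bound.mono fun _ ha => ha z₀ hz₀)
  · exact aestronglyMeasurable_deriv_param hρ (fun z hz => hF_meas z (hball hz))
      (hF_diff.mono fun _ ha => ha.differentiableAt (hU.mem_nhds hz₀))
  · filter_upwards [hF_diff, h_bound] with a ha hb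
    intro z hz
    have hsub : closedBall z (ρ / 4) ⊆ U := by
      refine (closedBall_subset_closedBall' ?_).trans hclosed
      have := mem_ball.mp hz
      linarith
    have hdc : DiffContOnCl ℂ (F · a) (ball z (ρ / 4)) := ha.diffContOnCl_ball hsub
    have hC : ∀ w ∈ sphere z (ρ / 4), ‖F w a‖ ≤ bound a := fun w hw =>
      hb w (hsub (sphere_subset_closedBall hw))
    exact Complex.norm_deriv_le_of_forall_mem_sphere_norm_le (by positivity) hdc hC
  · exact bound_int.div_const _
  · filter_upwards [hF_diff] with a ha
    intro z hz
    exact (ha.differentiableAt (hU.mem_nhds (hsU hz))).hasDerivAt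

/-- **Holomorphy of the parameter integral** on the open set `U`. -/
theorem differentiableOn_integral_of_dominated_on {U : Set ℂ} (hU : IsOpen U) {F : ℂ → α → E}
    {bound : α → ℝ} (hF_meas : ∀ z ∈ U, AEStronglyMeasurable (F z) μ)
    (hF_diff : ∀ᵐ a ∂μ, DifferentiableOn ℂ (F · a) U)
    (h_bound : ∀ᵐ a ∂μ, ∀ z ∈ U, ‖F z a‖ ≤ bound a) (bound_int : Integrable bound μ) :
    DifferentiableOn ℂ (fun z => ∫ a, F z a ∂μ) U :=
  fun _ hz => ((hasDerivAt_integral_of_dominated_on hU hF_meas hF_diff h_bound bound_int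
    hz).2).differentiableAt.differentiableWithinAt

/-- The derivative of the parameter integral is the integral of the derivative. -/
theorem deriv_integral_of_dominated_on {U : Set ℂ} (hU : IsOpen U) {F : ℂ → α → E}
    {bound : α → ℝ} (hF_meas : ∀ z ∈ U, AEStronglyMeasurable (F z) μ)
    (hF_diff : ∀ᵐ a ∂μ, DifferentiableOn ℂ (F · a) U)
    (h_bound : ∀ᵐ a ∂μ, ∀ z ∈ U, ‖F z a‖ ≤ bound a) (bound_int : Integrable bound μ)
    {z₀ : ℂ} (hz₀ : z₀ ∈ U) :
    deriv (fun z => ∫ a, F z a ∂μ) z₀ = ∫ a, deriv (F · a) z₀ ∂μ :=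
  (hasDerivAt_integral_of_dominated_on hU hF_meas hF_diff h_bound bound_int hz₀).2.deriv

/-- The open right half-plane `{s : c < Re s}` is open. -/
theorem isOpen_re_gt (c : ℝ) : IsOpen {s : ℂ | c < s.re} :=
  isOpen_lt continuous_const Complex.continuous_re

/-- **The (P1) shape**: an integrand holomorphic in `s` on the half-plane `Re s > c` for a.e. `a`,
measurable in `a`, and dominated on the whole half-plane by one integrable function, has a parameter
integral holomorphic on `Re s > c` («holomorphy on Re s > ½ − ε»). -/
theorem differentiableOn_integral_of_dominated_halfPlane {c : ℝ} {F : ℂ → α → E} {bound : α → ℝ}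
    (hF_meas : ∀ s : ℂ, c < s.re → AEStronglyMeasurable (F s) μ)
    (hF_diff : ∀ᵐ a ∂μ, DifferentiableOn ℂ (F · a) {s : ℂ | c < s.re})
    (h_bound : ∀ᵐ a ∂μ, ∀ s : ℂ, c < s.re → ‖F s a‖ ≤ bound a) (bound_int : Integrable bound μ) :
    DifferentiableOn ℂ (fun s => ∫ a, F s a ∂μ) {s : ℂ | c < s.re} :=
  differentiableOn_integral_of_dominated_on (isOpen_re_gt c) (fun s hs => hF_meas s hs) hF_diff
    (h_bound.mono fun _ ha s hs => ha s hs) bound_int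

omit [NormedSpace ℂ E] in
/-- The half-plane integrability statement («absolute convergence on Re s > c»). -/
theorem integrable_of_dominated_halfPlane {c : ℝ} {F : ℂ → α → E} {bound : α → ℝ}
    (hF_meas : ∀ s : ℂ, c < s.re → AEStronglyMeasurable (F s) μ)
    (h_bound : ∀ᵐ a ∂μ, ∀ s : ℂ, c < s.re → ‖F s a‖ ≤ bound a) (bound_int : Integrable bound μ) :
    ∀ s : ℂ, c < s.re → Integrable (F s) μ :=
  fun s hs => integrable_of_dominated_on (U := {s : ℂ | c < s.re}) (fun s hs => hF_meas s hs)
    (h_bound.mono fun _ ha s hs => ha s hs) bound_int s hs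

end Summit.Ventures.HodgeRepro2.T5ParametricHolomorphy
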